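import Summits.AtomisticToContinuum.BoseEinsteinCondensation.Theorems.BECInsertionCorrectorStaticResponseBoundFewBody5Final
import HarnessLib

/-!
# Skeleton (seat a1, v3 — final) — line `stable-fraction-square-completion`, few-body layer with the QUINTIC window

`StaticResponseBound_of : StaticResponseBound` BY NAME from ONE registered stub, `stub_coreWeak5` = the crux's large-`N`
(`N⁵ρa³ > 1`), linear-response-window (`t² ≤ ρa·max(ρa,|p|²)`) content, through the landed unconditional equivalence
`FewBody5.staticResponseBound_iff_coreWeak5` (headline file `…FewBody5Final`).  Everything else of the seat-a1 reshape LANDED: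
`stub_allCouplingPT` (N-free perturbation theory: `…FewBody5WeightedSquare` p122474, `…FewBody5AllCouplingCore` p123051,
`…FewBody5AllCouplingPT` p123681), `stub_fewBodyBounded5_of_allCouplingPT` p121688, `stub_fewBodyWindow5` p121608,
`stub_composition5` p121597, `stub_largeNHalf5_of_coreWeak5` p121678.  The few-body regime is now `E₀·L² ≤ 4π²/5` (no factor N),
the window `N⁵ρa³ ≤ c` (was `N⁸`).  The remaining stub is the N-uniform second-order (Bogoliubov) response bound of the dilute
Bose gas in the thermodynamic limit — research-open (CORE-c3.md; Lines/line-stable-fraction-square-completion-dead.md).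
-/

noncomputable section

namespace Summit.AtomisticToContinuum.BoseEinsteinCondensation.Cruxes.StaticResponseBound.FewBody5

open MeasureTheory Filter
open scoped ENNReal NNReal BigOperators
open Literature.MathematicalPhysics.QuantumManyBody.BoseGas
open Summit.AtomisticToContinuum.BoseEinsteinCondensation.Theses
open Summit.AtomisticToContinuum.BoseEinsteinCondensation.Theses.BECInsertionCorrector
open Summit.AtomisticToContinuum.BoseEinsteinCondensation.Theorems.StaticResponseBound.Negative
open Summit.AtomisticToContinuum.BoseEinsteinCondensation.Cruxes.StaticResponseBound.UvThomsonForceWave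
open Summit.AtomisticToContinuum.BoseEinsteinCondensation.Cruxes.StaticResponseBound.FewBody

/-- **Stub `stub_coreWeak5` (the irreducible core; crux-sized).**  The crux for `N⁵·ρa³ > c` on the linear-response
window `t² ≤ ρa·max(ρa,|p|²)`: the N-uniform second-order (Bogoliubov) response of the dilute Bose gas in the
thermodynamic limit, down to `p = 2π/L`.  Equivalent to the crux (`staticResponseBound_iff_coreWeak5`, `ε = 1`).  Not in print. -/
theorem stub_coreWeak5 :
    ∀ v : ℝ → ℝ≥0∞, IsRepulsiveFiniteRange v → ∀ c : ℝ, 0 < c →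
      ∃ ρ₀ : ℝ, 0 < ρ₀ ∧ ∃ C : ℝ, 0 < C ∧
        ∀ ρ : ℝ, 0 < ρ → ρ < ρ₀ → ∀ N : ℕ,
          c < (N : ℝ) ^ 5 * (ρ * (scatteringLength v).toReal ^ 3) →
          ∀ k : Fin 3 → ℤ, k ≠ 0 → ∀ t : ℝ,
            t ^ 2 ≤ (1 : ℝ) ^ 2 * (ρ * (scatteringLength v).toReal) *
              max (ρ * (scatteringLength v).toReal) (psq (sideLength ρ N) k) →
            ∀ Ψ : PeriodicTrialState N (sideLength ρ N), periodicEnergy v Ψ ≠ ⊤ → Ineq v C ρ N k t Ψ := by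
  sorry

/-- **Composition: the crux `StaticResponseBound` BY NAME from `stub_coreWeak5`** (landed equivalence at `ε = 1`). -/
theorem StaticResponseBound_of : StaticResponseBound :=
  (staticResponseBound_iff_coreWeak5 one_pos).mpr stub_coreWeak5

end Summit.AtomisticToContinuum.BoseEinsteinCondensation.Cruxes.StaticResponseBound.FewBody5

end
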